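import Summits.SmoothPoincare4.SmoothPoincare4.Theorems.SymplecticOrigamiGromovRecognitionRelEndSphereWedgeZerosFinite
import Mathlib.Analysis.Meromorphic.Order
import Mathlib.Analysis.Analytic.Order

/-!
# The intersection count of a `JX`-sphere with the sphere at infinity is nonnegative, and
positive when they meet
(registered helper `helper_sphereWedgeCountPos` of line `cross-cap-laurent`, crux
`GromovRecognitionRelEnd`, item stmt-SmoothPoincare4-11009)

Setting: `X` is a `C^∞` real `4`-manifold with a family of tangent-space endomorphisms `JX`,
`U ⊆ X` is open and `T : X → ℂ` is `C^∞` and `JX`-holomorphic on `U` (`dT (JX w) = i · dT w`),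
with `H∞ = {y ∈ U | T y = 0}` closed in `X` (the "sphere at infinity" of a wedge cap).  A
`JX`-holomorphic sphere is given in two-chart form: `C^∞` maps `u v : ℂ → X`, both
`J`-holomorphic (`Literature.Geometry.Symplectic.IsJHolomorphic`), with `v w = u w⁻¹` for `w ≠ 0`,
and the sphere is not contained in `H∞` (some `u z ∉ H∞`).  Its intersection count with `H∞` is
the sum of the orders of the zeros of the holomorphic function `f = T ∘ u` over the (finite,
`helper_sphereWedgeZerosFinite`) set `{z | u z ∈ H∞}`, plus the order of `g = T ∘ v` at `w = 0`
if the point at infinity `v 0` lies on `H∞`.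

Claim: this count is `≥ 0`, and `≥ 1` as soon as the sphere meets `H∞` (at some `u z`, or at
`v 0`).

Proof.  (a) Every summand is `≥ 0`: at a point of either index set the relevant function is
analytic (`helper_holCoordCompJHol` on the open preimage of `U`), so its meromorphic order is the
(nonnegative) analytic order (`AnalyticAt.meromorphicOrderAt_nonneg`); finsums of nonnegative terms
are nonnegative (`finsum_mem_induction`).
(b) If `u z₀ ∈ H∞`: `f` is not identically zero near `z₀`
(`eventually_ne_zero_of_interior_zeroSet_eq_empty`, `interior_zeroSet_eq_empty` from the sibling
file, using the witness `u z ∉ H∞`), and `f z₀ = 0`, so the meromorphic order of `f` at `z₀` is a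
positive integer (`tendsto_zero_iff_meromorphicOrderAt_pos`,
`meromorphicOrderAt_ne_top_iff_eventually_ne_zero`); a finite sum of nonnegative terms dominates
each term (`finsum_mem_eq_finite_toFinset_sum`, `Finset.single_le_sum`).
(c) If `v 0 ∈ H∞`: the second index set is `{0}` (`finsum_mem_singleton`); `g` is analytic at `0`,
vanishes there, and is not identically zero near `0` — otherwise, transporting through
`v w = u w⁻¹`, the zero set of `f` would contain a neighbourhood of infinity
(`Filter.tendsto_inv₀_cobounded'`), which is impossible for a finite (hence bounded) set; so the
order of `g` at `0` is `≥ 1` as in (b).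

References: principle of isolated zeros (Mathlib `Mathlib.Analysis.Analytic.IsolatedZeros`,
`Mathlib.Analysis.Meromorphic.Order`); D. McDuff, D. Salamon, *J-holomorphic Curves and Symplectic
Topology*, 2nd ed. (2012), §2.6 and App. E (local intersection numbers of `J`-curves with
`J`-hypersurfaces are positive).  No new definitions, notation or instances.
-/

noncomputable section

-- the prescribed namespace `Summit.<P>.<Sub>.…` duplicates `SmoothPoincare4` (P = Sub)
set_option linter.dupNamespace false

open scoped Manifold ContDiff Topology
open Set Filter Bornology
open Literature.Geometry.Symplectic

namespace Summit.SmoothPoincare4.SmoothPoincare4.Theorems.GromovRecognitionRelEnd.CrossCapLaurent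

/-- **A genuine isolated zero has order at least one.** If `f` is analytic at `z₀`, vanishes at
`z₀`, and is non-zero on a punctured neighbourhood of `z₀`, then `(meromorphicOrderAt f z₀).untop₀`
is `≥ 1`: the order is positive since `f → 0` along `𝓝[≠] z₀`
(`tendsto_zero_iff_meromorphicOrderAt_pos`) and finite since `f` is eventually non-zero
(`meromorphicOrderAt_ne_top_iff_eventually_ne_zero`). -/
theorem one_le_untop₀_meromorphicOrderAt_of_eventually_ne_zero {f : ℂ → ℂ} {z₀ : ℂ}
    (hf : AnalyticAt ℂ f z₀) (h0 : f z₀ = 0) (hne : ∀ᶠ w in 𝓝[≠] z₀, f w ≠ 0) :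
    1 ≤ (meromorphicOrderAt f z₀).untop₀ := by
  have hm : MeromorphicAt f z₀ := hf.meromorphicAt
  have hpos : 0 < meromorphicOrderAt f z₀ := by
    rw [← tendsto_zero_iff_meromorphicOrderAt_pos hm]
    have h := hf.continuousAt.tendsto
    rw [h0] at h
    exact h.mono_left nhdsWithin_le_nhds
  have htop : meromorphicOrderAt f z₀ ≠ ⊤ :=
    (meromorphicOrderAt_ne_top_iff_eventually_ne_zero hm).mpr hne
  obtain ⟨n, hn⟩ := WithTop.ne_top_iff_exists.mp htop
  rw [← hn] at hpos ⊢
  rw [WithTop.untop₀_coe]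
  have h1 : (0 : ℤ) < n := WithTop.coe_pos.mp hpos
  omega

/-- **The intersection count with the sphere at infinity is nonnegative, and positive when the
sphere meets it.**  For `U ⊆ X` open, `T : X → ℂ` smooth and `JX`-holomorphic on `U` with
`H∞ = {y ∈ U | T y = 0}` closed, and a `JX`-holomorphic sphere in two-chart form `u, v : ℂ → X`
(`C^∞`, `J`-holomorphic, `v w = u w⁻¹` for `w ≠ 0`) with some `u z ∉ H∞`, the count
`Σ_{u z ∈ H∞} ord_z (T ∘ u) + [v 0 ∈ H∞] · ord_0 (T ∘ v)` is `≥ 0`, and `≥ 1` if some `u z ∈ H∞` or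
`v 0 ∈ H∞`: each order is that of an analytic germ (nonnegative), and at a point of `H∞` the germ
vanishes without vanishing identically (isolated zeros, the sphere not lying in `H∞`), so its order
is `≥ 1`; the first index set is finite (`helper_sphereWedgeZerosFinite`).
[cite: McDuffSalamon2012, §2.6, App. E (positivity of local intersection numbers)] -/
theorem helper_sphereWedgeCountPos : ∀ (X : Type) [TopologicalSpace X] [ChartedSpace (EuclideanSpace ℝ (Fin 4)) X] [IsManifold (𝓡 4) ∞ X] (JX : ∀ y : X, TangentSpace (𝓡 4) y →L[ℝ] TangentSpace (𝓡 4) y) (T : X → ℂ) (U : Set X) (u v : ℂ → X), IsOpen U → ContMDiffOn (𝓡 4) 𝓘(ℝ, ℂ) ∞ T U → (∀ y ∈ U, ∀ w : TangentSpace (𝓡 4) y, (show ℂ from mfderiv (𝓡 4) 𝓘(ℝ, ℂ) T y (JX y w)) = Complex.I * (show ℂ from mfderiv (𝓡 4) 𝓘(ℝ, ℂ) T y w)) → IsClosed {y : X | y ∈ U ∧ T y = 0} → ContMDiff 𝓘(ℝ, ℂ) (𝓡 4) ∞ u → ContMDiff 𝓘(ℝ, ℂ) (𝓡 4) ∞ v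 → (∀ z : ℂ, z ≠ 0 → v z = u z⁻¹) → Literature.Geometry.Symplectic.IsJHolomorphic (𝓡 4) JX u → Literature.Geometry.Symplectic.IsJHolomorphic (𝓡 4) JX v → (∃ z : ℂ, ¬ (u z ∈ U ∧ T (u z) = 0)) → 0 ≤ (∑ᶠ z ∈ {z : ℂ | u z ∈ U ∧ T (u z) = 0}, (meromorphicOrderAt (T ∘ u) z).untop₀) + (∑ᶠ w ∈ {w : ℂ | w = 0 ∧ v w ∈ U ∧ T (v w) = 0}, (meromorphicOrderAt (T ∘ v) w).untop₀) ∧ (((∃ z : ℂ, u z ∈ U ∧ T (u z) = 0) ∨ (v 0 ∈ U ∧ T (v 0) = 0)) → 1 ≤ (∑ᶠ z ∈ {z : ℂ | u z ∈ U ∧ T (u z) = 0}, (meromorphicOrderAt (T ∘ u) z).untop₀) + (∑ᶠ w ∈ {w : ℂ | w = 0 ∧ v w ∈ U ∧ T (v w) = 0}, (meromorphicOrderAt (T ∘ v) w).untop₀)) := by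
  intro X _ _ _ JX T U u v hU hT hTJ hcl hu hv huv hJu hJv hex
  have huc : Continuous u := hu.continuous
  have hvc : Continuous v := hv.continuous
  have hO : IsOpen (u ⁻¹' U) := hU.preimage huc
  have hV : IsOpen (v ⁻¹' U) := hU.preimage hvc
  -- `f = T ∘ u` and `g = T ∘ v` are holomorphic on the preimages of `U`
  have hf : AnalyticOnNhd ℂ (T ∘ u) (u ⁻¹' U) :=
    (helper_holCoordCompJHol X JX T U u hU hT hTJ hu hJu).analyticOnNhd hO
  have hg : AnalyticOnNhd ℂ (T ∘ v) (v ⁻¹' U) :=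
    (helper_holCoordCompJHol X JX T U v hU hT hTJ hv hJv).analyticOnNhd hV
  -- the zero set `Z = {z | u z ∈ H∞}` is closed, finite, and has empty interior
  have hZcl : IsClosed {z : ℂ | u z ∈ U ∧ T (u z) = 0} := hcl.preimage huc
  have hfin : {z : ℂ | u z ∈ U ∧ T (u z) = 0}.Finite :=
    helper_sphereWedgeZerosFinite X JX T U u v hU hT hTJ hcl hu hv huv hJu hJv hex
  have hint : interior {z : ℂ | u z ∈ U ∧ T (u z) = 0} = ∅ :=
    interior_zeroSet_eq_empty (f := T ∘ u) (O := u ⁻¹' U) hO hf hZcl hex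
  -- (a) every summand is nonnegative (`AnalyticAt.meromorphicOrderAt_nonneg`), hence so are both
  -- finsums
  have hA : ∀ z ∈ {z : ℂ | u z ∈ U ∧ T (u z) = 0},
      0 ≤ (meromorphicOrderAt (T ∘ u) z).untop₀ :=
    fun z hz => WithTop.untop₀_nonneg.mpr (hf z hz.1).meromorphicOrderAt_nonneg
  have hB : ∀ w ∈ {w : ℂ | w = 0 ∧ v w ∈ U ∧ T (v w) = 0},
      0 ≤ (meromorphicOrderAt (T ∘ v) w).untop₀ :=
    fun w hw => WithTop.untop₀_nonneg.mpr (hg w hw.2.1).meromorphicOrderAt_nonneg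
  have hA0 : 0 ≤ ∑ᶠ z ∈ {z : ℂ | u z ∈ U ∧ T (u z) = 0},
      (meromorphicOrderAt (T ∘ u) z).untop₀ :=
    finsum_mem_induction (fun x => 0 ≤ x) le_rfl (fun _ _ => add_nonneg) hA
  have hB0 : 0 ≤ ∑ᶠ w ∈ {w : ℂ | w = 0 ∧ v w ∈ U ∧ T (v w) = 0},
      (meromorphicOrderAt (T ∘ v) w).untop₀ :=
    finsum_mem_induction (fun x => 0 ≤ x) le_rfl (fun _ _ => add_nonneg) hB
  refine ⟨add_nonneg hA0 hB0, ?_⟩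
  rintro (⟨z₀, hz₀⟩ | h0)
  · -- (b) the sphere meets `H∞` at `u z₀`: the order of `f` at `z₀` is `≥ 1`
    have h1 : 1 ≤ (meromorphicOrderAt (T ∘ u) z₀).untop₀ :=
      one_le_untop₀_meromorphicOrderAt_of_eventually_ne_zero (hf z₀ hz₀.1) hz₀.2
        (eventually_ne_zero_of_interior_zeroSet_eq_empty (f := T ∘ u) (O := u ⁻¹' U)
          hO hf hint hz₀.1)
    -- and a finite sum of nonnegative terms dominates each of its terms
    have h2 : (meromorphicOrderAt (T ∘ u) z₀).untop₀ ≤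
        ∑ᶠ z ∈ {z : ℂ | u z ∈ U ∧ T (u z) = 0}, (meromorphicOrderAt (T ∘ u) z).untop₀ := by
      rw [finsum_mem_eq_finite_toFinset_sum _ hfin]
      exact Finset.single_le_sum (fun z hz => hA z (hfin.mem_toFinset.mp hz))
        (hfin.mem_toFinset.mpr hz₀)
    linarith
  · -- (c) the sphere meets `H∞` at the point at infinity `v 0`
    have hset : {w : ℂ | w = 0 ∧ v w ∈ U ∧ T (v w) = 0} = {0} := by
      ext w
      simp only [mem_setOf_eq, mem_singleton_iff]
      exact ⟨fun h => h.1, fun h => ⟨h, h.symm ▸ h0⟩⟩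
    -- `g` is not identically zero near `0`: otherwise `Z` would contain a neighbourhood of
    -- infinity, impossible for a finite set
    have hne : ∀ᶠ w in 𝓝[≠] (0 : ℂ), (T ∘ v) w ≠ 0 := by
      rcases (hg 0 h0.1).eventually_eq_zero_or_eventually_ne_zero with h4 | h4
      · exfalso
        have h5 : ∀ᶠ w in 𝓝[≠] (0 : ℂ), w⁻¹ ∈ {z : ℂ | u z ∈ U ∧ T (u z) = 0} := by
          have h4' : ∀ᶠ w in 𝓝[≠] (0 : ℂ), (T ∘ v) w = 0 ∧ v w ∈ U :=
            nhdsWithin_le_nhds (h4.and (hV.mem_nhds h0.1))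
          filter_upwards [h4', self_mem_nhdsWithin] with w hw hw0
          show u w⁻¹ ∈ U ∧ T (u w⁻¹) = 0
          rw [← huv w hw0]
          exact ⟨hw.2, hw.1⟩
        have h6 : ∀ᶠ z in cobounded ℂ, z ∈ {z : ℂ | u z ∈ U ∧ T (u z) = 0} := by
          simpa only [inv_inv] using Filter.tendsto_inv₀_cobounded'.eventually h5
        have h7 : ∀ᶠ z in cobounded ℂ, z ∉ {z : ℂ | u z ∈ U ∧ T (u z) = 0} :=
          isBounded_def.mp hfin.isBounded
        obtain ⟨z, hz, hz'⟩ := (h6.and h7).exists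
        exact hz' hz
      · exact h4
    have h1 : 1 ≤ (meromorphicOrderAt (T ∘ v) 0).untop₀ :=
      one_le_untop₀_meromorphicOrderAt_of_eventually_ne_zero (hg 0 h0.1) h0.2 hne
    have h2 : ∑ᶠ w ∈ {w : ℂ | w = 0 ∧ v w ∈ U ∧ T (v w) = 0},
        (meromorphicOrderAt (T ∘ v) w).untop₀ = (meromorphicOrderAt (T ∘ v) 0).untop₀ := by
      rw [hset, finsum_mem_singleton]
    linarith

end Summit.SmoothPoincare4.SmoothPoincare4.Theorems.GromovRecognitionRelEnd.CrossCapLaurent
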